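import Literature.AlgebraicGeometry.HodgeTheory.CyclicCoverPencilModelIsotopy
import HarnessLib

/-!
# The model isotopy of the nodal pencil: joint continuity

Family `hodge`, layer `Literature/AlgebraicGeometry/HodgeTheory`; step A3b (fifth part). On the set `G` of points of the chart source whose affine
coordinates lie in the chart ball of the Morse chart and whose rotated coordinate vectors stay in the chart target (e.g. the good points of
`CyclicCoverPencilModelIsotopyProps.chartModelIsotopy_nodal_spec`), the model isotopy `(θ, x) ↦ J(θ, x) = Φ⁻¹(b'(x), Θ⁻¹R_θΘ y(x))` is jointly
continuous (`PhamBrieskornWeightedRotation.continuousOn_modelIsotopy`, continuity of `Φ` on its source and of `Φ⁻¹` at points of its target) —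
hypothesis `hIcont` of `Geometry/Manifold/ShellInterpolatedIsotopyPunctured`.

* `continuousOn_chartModelIsotopy`.

Everything is proved; no definitions, no named facts.

## References

* [Milnor1968] J. Milnor, Singular Points of Complex Hypersurfaces (1968), §9 Lemma 9.4.
-/

noncomputable section

open Set Function Complex Filter Topology
open Literature.AlgebraicGeometry.Motives Literature.AlgebraicGeometry.Motives.UniversalHypersurface
open Literature.Geometry.ComplexAnalytic

namespace Literature.AlgebraicGeometry.HodgeTheory

/-- **Joint continuity of the model isotopy** on `ℝ × G`. [cite: Milnor1968, §9 Lemma 9.4] -/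
theorem continuousOn_chartModelIsotopy {n d : ℕ} {i : Fin (n + 2)} (a : Fin (n + 1) → ℕ)
    (Φ : OpenPartialHomeomorph (ComplexPoints (regularTotal ℂ n d)) (({m : DegIndex n d // m ≠ regPowIndex n d i} ⊕ Fin (n + 1)) → ℂ))
    (Θ : OpenPartialHomeomorph (Fin (n + 1) → ℂ) (Fin (n + 1) → ℂ)) {r : ℝ}
    (hr : {z : Fin (n + 1) → ℂ | ∑ k, ‖z k‖ ^ 2 ≤ r ^ 2} ⊆ Θ.target) :
    ContinuousOn (fun q : ℝ × ComplexPoints (regularTotal ℂ n d) => chartModelIsotopy a Φ Θ q.1 q.2)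
      (univ ×ˢ {x | x ∈ Φ.source ∧ (fun j => Φ x (Sum.inr j)) ∈ Θ.source ∧ ∑ k, ‖Θ (fun j => Φ x (Sum.inr j)) k‖ ^ 2 < r ^ 2 ∧
        ∀ θ : ℝ, (Sum.elim (fun m => Φ x (Sum.inl m))
          (Θ.symm (fun k => Complex.exp (((θ / a k : ℝ) : ℂ) * I) * Θ (fun j => Φ x (Sum.inr j)) k)) :
            ({m : DegIndex n d // m ≠ regPowIndex n d i} ⊕ Fin (n + 1)) → ℂ) ∈ Φ.target}) := by
  set G := {x : ComplexPoints (regularTotal ℂ n d) | x ∈ Φ.source ∧ (fun j => Φ x (Sum.inr j)) ∈ Θ.source ∧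
      ∑ k, ‖Θ (fun j => Φ x (Sum.inr j)) k‖ ^ 2 < r ^ 2 ∧
      ∀ θ : ℝ, (Sum.elim (fun m => Φ x (Sum.inl m))
        (Θ.symm (fun k => Complex.exp (((θ / a k : ℝ) : ℂ) * I) * Θ (fun j => Φ x (Sum.inr j)) k)) :
          ({m : DegIndex n d // m ≠ regPowIndex n d i} ⊕ Fin (n + 1)) → ℂ) ∈ Φ.target} with hG
  -- the inner map `(θ, x) ↦ (b'(x), Θ⁻¹ R_θ Θ y(x))`
  set inner : ℝ × ComplexPoints (regularTotal ℂ n d) → (({m : DegIndex n d // m ≠ regPowIndex n d i} ⊕ Fin (n + 1)) → ℂ) :=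
    fun q' => Sum.elim (fun m => Φ q'.2 (Sum.inl m))
      (Θ.symm (fun k => Complex.exp (((q'.1 / a k : ℝ) : ℂ) * I) * Θ (fun j => Φ q'.2 (Sum.inr j)) k)) with hinner
  -- `Φ ∘ snd` is continuous on `univ ×ˢ G`
  have hΦ2 : ContinuousOn (fun q' : ℝ × ComplexPoints (regularTotal ℂ n d) => Φ q'.2) (univ ×ˢ G) :=
    Φ.continuousOn.comp continuousOn_snd fun q' hq' => (mem_prod.mp hq').2.1
  have hy2 : ContinuousOn (fun q' : ℝ × ComplexPoints (regularTotal ℂ n d) => fun j => Φ q'.2 (Sum.inr j)) (univ ×ˢ G) :=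
    continuousOn_pi.mpr fun j => (continuous_apply (Sum.inr j)).comp_continuousOn hΦ2
  -- the model isotopy part
  have hM := PhamBrieskorn.continuousOn_modelIsotopy a Θ hr
  have hM2 : ContinuousOn (fun q' : ℝ × ComplexPoints (regularTotal ℂ n d) =>
      Θ.symm (fun k => Complex.exp (((q'.1 / a k : ℝ) : ℂ) * I) * Θ (fun j => Φ q'.2 (Sum.inr j)) k)) (univ ×ˢ G) := by
    have h := hM.comp (continuousOn_fst.prodMk hy2) (fun q' hq' => ?_)
    · exact h
    · have hq2 := (mem_prod.mp hq').2
      exact mem_prod.mpr ⟨mem_univ _, hq2.2.1, hq2.2.2.1⟩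
  have hinner_c : ContinuousOn inner (univ ×ˢ G) := by
    refine continuousOn_pi.mpr fun s => ?_
    rcases s with m | j
    · exact (continuous_apply (Sum.inl m)).comp_continuousOn hΦ2
    · exact (continuous_apply j).comp_continuousOn hM2
  have hcomp : ContinuousOn (fun q' => Φ.symm (inner q')) (univ ×ˢ G) :=
    Φ.continuousOn_symm.comp hinner_c fun q' hq' => (mem_prod.mp hq').2.2.2.2 q'.1
  refine hcomp.congr fun q' hq' => ?_
  exact chartModelIsotopy_of_mem a Φ Θ (mem_prod.mp hq').2.1

end Literature.AlgebraicGeometry.HodgeTheory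

end
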